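import Summits.QuantumFields.BalabanUV.Beta.D1BFx.GhostLegBlockMassD1Summed
import Summits.QuantumFields.BalabanUV.Beta.D1BFx.ProjectorColumnSharp

/-!
# `BalabanUV.Beta.D1BFx.RColumnBlockMass` — road «BF-x» for binder row D1, slot (K), END row `hGrp gN`, «GN-L3» PART 2b (owner ruling ρ-g9-33 (L2)∕(L3)):
# THE BLOCK |·|-MASSES OF `RG (Ggh n a) (Pgt n a) = Ggh − Pgt∘Ggh` IN EITHER SLOT AND OF ITS THREE FIRST DIFFERENCES, n-FREE CONSTANTS, BLOCK DECAY:
# `Σ_{x∈B(β)}|RG(x,s)| ≤ cR(a)·e^{−dR(a)·dist(β, blk s)}`, `Σ_{s∈B(γ)}|RG(x,s)| ≤ cR(a)·e^{−dR(a)·dist(blk x, γ)}`, the d1 twins `≤ cRd(a)∕n·e^{…}`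
# (the block form of an3 §3′ (2)'s `m_ρ = O(1)`, `m_{δρ} = m′_ρ = O(n⁻¹)` and of §3′ (6)'s «M10 = `Σ_{s∈B}|RG(x,s)| ≤ k` and its d1 twin `≤ k∕n`»)

HONEST DEPENDENCY (cell records, verbatim): «continuum YM on T⁴ ⇐ BetaPertH ∧ nine spine estimates (0/9 proved); BetaPertH ⇐ (D1) ∧ (D4) ∧
CAP+tail; G-an2-4 gates asym, D1 and NE2/3/4.»  HONEST FRAMING (cell contract, verbatim): «discharging `BetaPertH` makes Bałaban's UV stability
UNCONDITIONAL — a real constructive-QFT result; it is NOT the continuum limit and NOT the Clay problem.»  THIS MODULE DISCHARGES NOTHING of the wall: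
[folklore] block bookkeeping over tree theorems BY NAME — M10 `GhostLegBlockMass.sum_B_abs_Ggh_le` (p257692), M10-d1 `GhostLegBlockMassD1.sum_B_abs_Ggh_diff_le ∕ _col_le`
(p259362), `GhostLegBlockMassD1Summed.sum_B_abs_Ggh_diff_summed_le` (PART 2a), M4 `ProjectorColumnSharp.sum_B_abs_Pgt_le_sup ∕ _row_ ∕ _diff_ ∕ _diff_right_` (p257233),
the block convolution `BlockColumnSupNorm.abs_tsum_mul_le_of_decay` and the block regrouping `NeedleRowLetters.tsum_eq_tsum_blocks`; no `def … : Prop`, no hypothesis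
is a printed statement, 0 binders of row D1 touched; (K) NOT closed; NOT (CONV-C), NOT D1, NOT BetaPertH, NOT continuum, NOT Clay.
WHY (owner ρ-g9-33 (L2) «R-column envelope … + M10; not `abs_RG_road_le` +n²»): the n-free SUP letter `NeedleRowLetters.abs_RG_road_le` is `n²` above the envelope;
the currency of the T₃∕T₁∕T₂ count is the MASS of `RG` over a block (n-free — no `n⁴` from the `n⁴` sites), decaying in the block distance, `n⁻¹` more per difference.
`RG = Ggh − Pgt∘Ggh`: the `Ggh` term is M10 ∕ M10-d1 verbatim; the `Pgt∘Ggh` term is ONE block convolution of an M4 block column∕row of `Pgt` against an M10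
block column∕row of `Ggh` (§1 `sum_abs_tsum_le_conv`, the only analytic step here).
CONTENT ([folklore]; `B = B (n−1)`, `blk = blk (n−1)`, `X 4 = Fin 4 → ℤ`, sup-metric `dist`, `K₄ = latticeConst 4`; `[NeZero n]`, `0 < a`; constants
**`dR a := min(δ_PP(4,a), ghDelta a)∕2`**, **`cR a := cNear a·(1 + cPPs(4,a)·K₄(ghDelta a∕2))`**, **`cRd a := (cNear a + cNear1 a)·(1 + cPPs(4,a)·K₄(ghDelta a∕2))`**):
§1 the workhorse **`sum_abs_tsum_le_conv`** and summabilities (`summable_abs_RG_col`, shifted∕differenced); §2 COLUMNS (`s` fixed, `x` summed):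
**`sum_B_abs_RG_col_le`**, **`sum_B_abs_RG_col_diff_le`** (difference in `s`), **`sum_B_abs_RG_diff_col_le`** (difference in the summed `x`); §3 ROWS (`x` fixed,
`s` summed): **`sum_B_abs_RG_row_le`**, **`sum_B_abs_RG_diff_row_le`** (difference in `x`).  NOT HERE: the fine-`ℓ¹` masses and the needle potential `row_u`
(PART 2c `NeedlePotentialLetters`); the thin-needle profile `Φ_u`; any END row.
Unit `b2b-balaban-gan24-formalise-leaf-05` (gen 41), G-an2-4 swarm leaf prover on cross-lane kernel duty; `LEAVES-BFx.md` row (N) «GN-L3» PART 2b.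
-/

namespace Summit.QuantumFields.BalabanUV.Beta.D1BFx.RColumnBlockMass

open Finset
open scoped BigOperators
open Literature.MathematicalPhysics.QuantumFieldTheory.Balaban1983to89
open Literature.MathematicalPhysics.QuantumFieldTheory.Balaban1983to89.Beta
open B4Sect5Proof (latticeConst latticeConst_nonneg)
open B5Hk103ScalarZd (summable_expX)
open B6QGQLower276 (X e blk B mem_B)
open B6QGQDecay237 (deltaU deltaU_pos)
open ExpKernelCalculus (comp summable_exp_shift')
open AffineAveraging (unitVec)
open Summit.QuantumFields.BalabanUV.Beta.TameKernelCalculus (decays_of_le)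
open Summit.QuantumFields.BalabanUV.Beta.D1BFx.RProjector (Pgt Pgt_symm abs_tsum_le_latticeConst deltaPP deltaPP_pos)
open Summit.QuantumFields.BalabanUV.Beta.D1BFx.ProjectorSupNorm (cPPs cPPs_nonneg decays_Pgt_sup)
open Summit.QuantumFields.BalabanUV.Beta.D1BFx.ProjectorColumnSharp (sum_B_abs_Pgt_le_sup sum_B_abs_Pgt_row_le_sup sum_B_abs_Pgt_diff_le_sup
  sum_B_abs_Pgt_diff_right_le_sup)
open Summit.QuantumFields.BalabanUV.Beta.D1BFx.GhostLeg (Ggh Ggh_symm decays_Ggh)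
open Summit.QuantumFields.BalabanUV.Beta.D1BFx.RProjectorJet (RG decays_RG)
open Summit.QuantumFields.BalabanUV.Beta.D1BFx.RdotBlockRange (summable_Pgt_mul_Ggh)
open Summit.QuantumFields.BalabanUV.Beta.D1BFx.NeedleRowLetters (hasSum_blocks tsum_eq_tsum_blocks)
open Summit.QuantumFields.BalabanUV.Beta.D1BFx.BlockColumnSupNorm (abs_tsum_mul_le_of_decay)
open Summit.QuantumFields.BalabanUV.Beta.D1BFx.GhostLegFree (ghDelta ghDelta_pos)
open Summit.QuantumFields.BalabanUV.Beta.D1BFx.PointColumnSplit (cG0 cG0_nonneg cSplit cSplit_nonneg)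
open Summit.QuantumFields.BalabanUV.Beta.D1BFx.GhostLegBlockMass (cNear ghA0_pos sum_B_abs_Ggh_le)
open Summit.QuantumFields.BalabanUV.Beta.D1BFx.GhostLegBlockMassD1 (cNear1 ghA1_nonneg sum_B_abs_Ggh_diff_le sum_B_abs_Ggh_diff_col_le)
open Summit.QuantumFields.BalabanUV.Beta.D1BFx.GhostLegBlockMassD1Summed (sum_B_abs_Ggh_diff_summed_le)

noncomputable section

/-- [our constant] The rate of the `R∘G′` letters: half the smaller of the projector rate `δ_PP(4,a)` and the ghost rate `ghDelta a`. -/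
def dR (a : ℝ) : ℝ := min (deltaPP 4 a) (ghDelta a) / 2

/-- [our constant] The block-mass constant of `R∘G′`: `cNear a·(1 + cPPs(4,a)·K₄(ghDelta a∕2))`. -/
def cR (a : ℝ) : ℝ := cNear a * (1 + cPPs 4 a * latticeConst 4 (ghDelta a / 2))

/-- [our constant] The d1 block-mass constant of `R∘G′` (all three differences): `(cNear a + cNear1 a)·(1 + cPPs(4,a)·K₄(ghDelta a∕2))`. -/
def cRd (a : ℝ) : ℝ := (cNear a + cNear1 a) * (1 + cPPs 4 a * latticeConst 4 (ghDelta a / 2))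

variable {a : ℝ}

/-- [folklore] `0 < dR a`. -/
theorem dR_pos (ha : 0 < a) : 0 < dR a := by
  unfold dR; have := deltaPP_pos 4 ha; have := ghDelta_pos ha; positivity

/-- [folklore] Rate conversion: `e^{−ghDelta·D} ≤ e^{−dR·D}` for `D ≥ 0` (`dR ≤ ghDelta`). -/
theorem exp_ghDelta_le_exp_dR (ha : 0 < a) {D : ℝ} (hD : 0 ≤ D) : Real.exp (-(ghDelta a * D)) ≤ Real.exp (-(dR a * D)) := by
  have h : dR a ≤ ghDelta a := by unfold dR; have := min_le_right (deltaPP 4 a) (ghDelta a); linarith [ghDelta_pos ha]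
  exact Real.exp_le_exp.2 (by nlinarith)

/-- [folklore] `0 ≤ cNear a`. -/
theorem cNear_nonneg (ha : 0 < a) : 0 ≤ cNear a := by
  unfold cNear; have := ghA0_pos ha; have : 0 < min 2 a := lt_min two_pos ha; positivity

/-- [folklore] `0 ≤ cNear1 a`. -/
theorem cNear1_nonneg (ha : 0 < a) : 0 ≤ cNear1 a := by
  unfold cNear1; have := ghA1_nonneg ha; have := cG0_nonneg 4; have := cSplit_nonneg 4 ha; positivity

/-- [folklore] `0 ≤ 1 + cPPs·K₄(ghDelta∕2)`. -/
theorem one_add_nonneg (ha : 0 < a) : 0 ≤ 1 + cPPs 4 a * latticeConst 4 (ghDelta a / 2) := by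
  have := mul_nonneg (cPPs_nonneg 4 ha) (latticeConst_nonneg 4 (half_pos (ghDelta_pos ha)).le); linarith

/-- [folklore] `0 ≤ cR a`. -/
theorem cR_nonneg (ha : 0 < a) : 0 ≤ cR a := mul_nonneg (cNear_nonneg ha) (one_add_nonneg ha)

/-- [folklore] `0 ≤ cRd a`. -/
theorem cRd_nonneg (ha : 0 < a) : 0 ≤ cRd a := mul_nonneg (add_nonneg (cNear_nonneg ha) (cNear1_nonneg ha)) (one_add_nonneg ha)

/-- [folklore] `cNear1·(1 + cPPs·K) ≤ cRd`. -/
theorem cRd_bound₁ (ha : 0 < a) : cNear1 a * (1 + cPPs 4 a * latticeConst 4 (ghDelta a / 2)) ≤ cRd a := by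
  unfold cRd; nlinarith [cNear_nonneg ha, one_add_nonneg ha]

/-- [folklore] `cNear1 + cPPs·cNear·K ≤ cRd`. -/
theorem cRd_bound₂ (ha : 0 < a) : cNear1 a + cPPs 4 a * cNear a * latticeConst 4 (ghDelta a / 2) ≤ cRd a := by
  unfold cRd
  have hK := mul_nonneg (cPPs_nonneg 4 ha) (latticeConst_nonneg 4 (half_pos (ghDelta_pos ha)).le)
  nlinarith [cNear_nonneg ha, cNear1_nonneg ha, mul_nonneg (cNear1_nonneg ha) hK]

variable (n : ℕ) [NeZero n]

omit [NeZero n] in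
/-- [folklore] **THE BLOCK CONVOLUTION WORKHORSE.**  For a finite family of summable `F i : ℤ⁴ → ℝ` whose joint block masses factor as
`Σ_{z∈B(w)} Σ_i |F i z| ≤ f w · g w` with `0 ≤ f ≤ A·e^{−α·dist(p,·)}` and `0 ≤ g ≤ B·e^{−β·dist(·,q)}`:
`Σ_i |Σ'_z F i z| ≤ A·B·K₄(β∕2)·e^{−(min α β∕2)·dist(p,q)}` (`norm_tsum_le_tsum_norm`, `tsum_finsetSum`, block regrouping, `BlockColumnSupNorm.abs_tsum_mul_le_of_decay`). -/
theorem sum_abs_tsum_le_conv {ι : Type*} (S : Finset ι) (F : ι → X 4 → ℝ) (hF : ∀ i ∈ S, Summable (F i))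
    {f g : X 4 → ℝ} {A Bc α β : ℝ} (hα : 0 < α) (hβ : 0 < β) (hA : 0 ≤ A) (hB : 0 ≤ Bc) (p q : X 4)
    (hblk : ∀ w, ∑ z ∈ B (n - 1) w, ∑ i ∈ S, |F i z| ≤ f w * g w) (hf0 : ∀ w, 0 ≤ f w) (hg0 : ∀ w, 0 ≤ g w)
    (hf : ∀ w, f w ≤ A * Real.exp (-(α * dist p w))) (hg : ∀ w, g w ≤ Bc * Real.exp (-(β * dist w q))) :
    ∑ i ∈ S, |∑' z, F i z| ≤ A * Bc * latticeConst 4 (β / 2) * Real.exp (-(min α β / 2 * dist p q)) := by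
  have hS : Summable fun z : X 4 => ∑ i ∈ S, |F i z| := summable_sum fun i hi => (hF i hi).abs
  have h1 : ∑ i ∈ S, |∑' z, F i z| ≤ ∑ i ∈ S, ∑' z, |F i z| := by
    refine Finset.sum_le_sum fun i hi => ?_
    have h := norm_tsum_le_tsum_norm (hF i hi).norm
    simpa only [Real.norm_eq_abs] using h
  have h2 : ∑ i ∈ S, ∑' z, |F i z| = ∑' w, ∑ z ∈ B (n - 1) w, ∑ i ∈ S, |F i z| := by
    rw [← Summable.tsum_finsetSum (fun i hi => (hF i hi).abs), tsum_eq_tsum_blocks (n - 1) hS]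
  have hfg : Summable fun w : X 4 => f w * g w := by
    refine Summable.of_nonneg_of_le (fun w => mul_nonneg (hf0 w) (hg0 w)) (fun w => ?_) ((summable_expX hβ q).mul_left (A * Bc))
    have e1 : Real.exp (-(α * dist p w)) ≤ 1 := by
      rw [Real.exp_le_one_iff, neg_nonpos]; exact mul_nonneg hα.le dist_nonneg
    rw [dist_comm q w]
    calc f w * g w ≤ (A * Real.exp (-(α * dist p w))) * (Bc * Real.exp (-(β * dist w q))) :=
          mul_le_mul (hf w) (hg w) (hg0 w) (mul_nonneg hA (Real.exp_pos _).le)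
      _ ≤ (A * 1) * (Bc * Real.exp (-(β * dist w q))) :=
          mul_le_mul_of_nonneg_right (mul_le_mul_of_nonneg_left e1 hA) (mul_nonneg hB (Real.exp_pos _).le)
      _ = A * Bc * Real.exp (-(β * dist w q)) := by ring
  have hblkS : Summable fun w : X 4 => ∑ z ∈ B (n - 1) w, ∑ i ∈ S, |F i z| := (hasSum_blocks (n - 1) hS.hasSum).summable
  have h3 : ∑' w, ∑ z ∈ B (n - 1) w, ∑ i ∈ S, |F i z| ≤ ∑' w, f w * g w := Summable.tsum_le_tsum hblk hblkS hfg
  have h4 : ∑' w, f w * g w ≤ A * Bc * latticeConst 4 (β / 2) * Real.exp (-(min α β / 2 * dist p q)) :=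
    (le_abs_self _).trans (abs_tsum_mul_le_of_decay hα hβ hA hB p q
      (fun w => by rw [abs_of_nonneg (hf0 w)]; exact hf w) (fun w => by rw [abs_of_nonneg (hg0 w)]; exact hg w))
  exact h1.trans (h2 ▸ h3.trans h4)

/-- [folklore] Unfolding: `(Pgt∘Ggh)(x,s) = Σ'_z Pgt(x,z)·Ggh(z,s)` (fibre `Unit`). -/
theorem comp_apply_unit (x s : X 4) : comp (Pgt n a) (Ggh n a) x s () () = ∑' z : X 4, Pgt n a x z () () * Ggh n a z s () () := by
  simp only [comp, Fintype.sum_unique]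

/-- [folklore] Unfolding: `RG(x,s) = Ggh(x,s) − Σ'_z Pgt(x,z)·Ggh(z,s)`. -/
theorem RG_apply (x s : X 4) :
    RG (Ggh n a) (Pgt n a) x s () () = Ggh n a x s () () - ∑' z : X 4, Pgt n a x z () () * Ggh n a z s () () := by
  show Ggh n a x s () () - comp (Pgt n a) (Ggh n a) x s () () = _
  rw [comp_apply_unit]

/-- [folklore] The column `x ↦ |RG(x,s)|` is summable over `ℤ⁴` (`RProjectorJet.decays_RG` at the common rate of `decays_Ggh`∕`decays_Pgt_sup`). -/
theorem summable_abs_RG_col (ha : 0 < a) (s : X 4) : Summable fun x : X 4 => |RG (Ggh n a) (Pgt n a) x s () ()| := by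
  have hn : (0 : ℝ) < n := Nat.cast_pos.mpr (Nat.pos_of_ne_zero (NeZero.ne n))
  have hδ0 : 0 < min (deltaU 4 a / (4 * n)) (deltaPP 4 a / (4 * (n : ℝ))) :=
    lt_min (div_pos (deltaU_pos 4 ha) (by positivity)) (div_pos (deltaPP_pos 4 ha) (by positivity))
  have hG := decays_of_le (decays_Ggh n a ha) (min_le_left (deltaU 4 a / (4 * n)) (deltaPP 4 a / (4 * (n : ℝ))))
  have hP := decays_of_le (decays_Pgt_sup n ha) (min_le_right (deltaU 4 a / (4 * n)) (deltaPP 4 a / (4 * (n : ℝ))))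
  have hR := decays_RG hG hP hδ0
  exact Summable.of_nonneg_of_le (fun _ => abs_nonneg _) (fun x => hR x s () ()) ((summable_exp_shift' (half_pos hδ0) s).mul_left _)

/-- [folklore] The summed-variable difference column is summable. -/
theorem summable_abs_RG_diff_col (ha : 0 < a) (s : X 4) (ρ : Fin 4) :
    Summable fun x : X 4 => |RG (Ggh n a) (Pgt n a) (x + unitVec ρ) s () () - RG (Ggh n a) (Pgt n a) x s () ()| :=
  Summable.of_nonneg_of_le (fun _ => abs_nonneg _) (fun _ => abs_sub _ _)
    (((summable_abs_RG_col n ha s).comp_injective (add_left_injective (unitVec ρ))).add (summable_abs_RG_col n ha s))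

/-- [folklore] The fixed-variable difference column is summable. -/
theorem summable_abs_RG_col_diff (ha : 0 < a) (s : X 4) (ρ : Fin 4) :
    Summable fun x : X 4 => |RG (Ggh n a) (Pgt n a) x (s + unitVec ρ) () () - RG (Ggh n a) (Pgt n a) x s () ()| :=
  Summable.of_nonneg_of_le (fun _ => abs_nonneg _) (fun _ => abs_sub _ _)
    ((summable_abs_RG_col n ha (s + unitVec ρ)).add (summable_abs_RG_col n ha s))

omit [NeZero n] in
/-- [folklore] Splitting a block sum of `|A − B|`. -/
theorem sum_abs_sub_le {ι : Type*} {S : Finset ι} {A T : ι → ℝ} {c₁ c₂ : ℝ} (h1 : ∑ i ∈ S, |A i| ≤ c₁) (h2 : ∑ i ∈ S, |T i| ≤ c₂) :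
    ∑ i ∈ S, |A i - T i| ≤ c₁ + c₂ :=
  (Finset.sum_le_sum fun i _ => abs_sub (A i) (T i)).trans (by rw [Finset.sum_add_distrib]; exact add_le_add h1 h2)

/-- [folklore] M10 in column form: `Σ_{z∈B(w)}|Ggh z s| ≤ cNear a·e^{−ghDelta a·dist(w, blk s)}` (`Ggh_symm`). -/
theorem sum_B_abs_Ggh_col_le (ha : 0 < a) (s w : X 4) :
    ∑ z ∈ B (n - 1) w, |Ggh n a z s () ()| ≤ cNear a * Real.exp (-(ghDelta a * dist w (blk (n - 1) s))) := by
  have h := sum_B_abs_Ggh_le n ha s w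
  rw [dist_comm] at h
  exact le_trans (le_of_eq (Finset.sum_congr rfl fun z _ => by rw [Ggh_symm n a ha z s () ()])) h

/-! ## §2 Columns: `s` fixed, `x` summed over a block -/

/-- [folklore] **THE R-COLUMN BLOCK MASS** (an3 §3′ (2) `m_ρ`-class, block form): `Σ_{x ∈ B(β)} |RG(x,s)| ≤ cR a · e^{−dR a·dist(β, blk s)}` — M10 (column form,
`Ggh_symm`) for `Ggh`, and for `Pgt∘Ggh` the M4 block column of `Pgt` convolved with the M10 block column of `Ggh`. -/
theorem sum_B_abs_RG_col_le (ha : 0 < a) (s β : X 4) :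
    ∑ x ∈ B (n - 1) β, |RG (Ggh n a) (Pgt n a) x s () ()| ≤ cR a * Real.exp (-(dR a * dist β (blk (n - 1) s))) := by
  have hcol := sum_B_abs_Ggh_col_le n ha s
  have h1 : ∑ x ∈ B (n - 1) β, |Ggh n a x s () ()| ≤ cNear a * Real.exp (-(dR a * dist β (blk (n - 1) s))) :=
    (hcol β).trans (mul_le_mul_of_nonneg_left (exp_ghDelta_le_exp_dR ha dist_nonneg) (cNear_nonneg ha))
  have h2 : ∑ x ∈ B (n - 1) β, |∑' z : X 4, Pgt n a x z () () * Ggh n a z s () ()|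
      ≤ cPPs 4 a * cNear a * latticeConst 4 (ghDelta a / 2) * Real.exp (-(dR a * dist β (blk (n - 1) s))) := by
    refine sum_abs_tsum_le_conv n (B (n - 1) β) (fun x z => Pgt n a x z () () * Ggh n a z s () ()) (fun x _ => summable_Pgt_mul_Ggh n ha x s)
      (f := fun w => cPPs 4 a * Real.exp (-(deltaPP 4 a * dist β w))) (g := fun w => ∑ z ∈ B (n - 1) w, |Ggh n a z s () ()|)
      (deltaPP_pos 4 ha) (ghDelta_pos ha) (cPPs_nonneg 4 ha) (cNear_nonneg ha) β (blk (n - 1) s) (fun w => ?_)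
      (fun w => mul_nonneg (cPPs_nonneg 4 ha) (Real.exp_pos _).le) (fun w => Finset.sum_nonneg fun z _ => abs_nonneg _) (fun w => le_rfl) hcol
    show ∑ z ∈ B (n - 1) w, ∑ x ∈ B (n - 1) β, |Pgt n a x z () () * Ggh n a z s () ()|
      ≤ (cPPs 4 a * Real.exp (-(deltaPP 4 a * dist β w))) * ∑ z ∈ B (n - 1) w, |Ggh n a z s () ()|
    rw [Finset.mul_sum]
    refine Finset.sum_le_sum fun z hz => ?_
    rw [show ∑ x ∈ B (n - 1) β, |Pgt n a x z () () * Ggh n a z s () ()| = (∑ x ∈ B (n - 1) β, |Pgt n a x z () ()|) * |Ggh n a z s () ()| by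
      rw [Finset.sum_mul]; exact Finset.sum_congr rfl fun x _ => abs_mul _ _]
    refine mul_le_mul_of_nonneg_right ?_ (abs_nonneg _)
    have hP := sum_B_abs_Pgt_le_sup n ha z β () ()
    rwa [mem_B.1 hz] at hP
  calc ∑ x ∈ B (n - 1) β, |RG (Ggh n a) (Pgt n a) x s () ()|
      = ∑ x ∈ B (n - 1) β, |Ggh n a x s () () - ∑' z : X 4, Pgt n a x z () () * Ggh n a z s () ()| :=
        Finset.sum_congr rfl fun x _ => by rw [RG_apply]
    _ ≤ _ := sum_abs_sub_le h1 h2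
    _ = cR a * Real.exp (-(dR a * dist β (blk (n - 1) s))) := by unfold cR; ring

/-- [folklore] **THE R-COLUMN BLOCK MASS OF THE DIFFERENCE IN THE FIXED SLOT** (`m_{δρ}`-class, `δρ_u = RG(·,u+e_ρ) − RG(·,u)`):
`Σ_{x ∈ B(β)} |RG(x,s+e_ρ) − RG(x,s)| ≤ cRd a∕n · e^{−dR a·dist(β, blk s)}` (M10-d1 column form + M4 ⊛ M10-d1). -/
theorem sum_B_abs_RG_col_diff_le (ha : 0 < a) (s β : X 4) (ρ : Fin 4) :
    ∑ x ∈ B (n - 1) β, |RG (Ggh n a) (Pgt n a) x (s + unitVec ρ) () () - RG (Ggh n a) (Pgt n a) x s () ()|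
      ≤ cRd a / n * Real.exp (-(dR a * dist β (blk (n - 1) s))) := by
  have hn : (0 : ℝ) < n := Nat.cast_pos.mpr (Nat.pos_of_ne_zero (NeZero.ne n))
  set u : X 4 := unitVec ρ with hu
  set E := Real.exp (-(dR a * dist β (blk (n - 1) s))) with hE
  have hcol : ∀ w, ∑ z ∈ B (n - 1) w, |Ggh n a z (s + u) () () - Ggh n a z s () ()|
      ≤ cNear1 a / n * Real.exp (-(ghDelta a * dist w (blk (n - 1) s))) := by
    intro w
    have h := sum_B_abs_Ggh_diff_col_le n ha s w ρ
    rwa [dist_comm] at h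
  have h1 : ∑ x ∈ B (n - 1) β, |Ggh n a x (s + u) () () - Ggh n a x s () ()| ≤ cNear1 a / n * E :=
    (hcol β).trans (mul_le_mul_of_nonneg_left (exp_ghDelta_le_exp_dR ha dist_nonneg) (div_nonneg (cNear1_nonneg ha) hn.le))
  have h2 : ∑ x ∈ B (n - 1) β, |∑' z : X 4, (Pgt n a x z () () * Ggh n a z (s + u) () () - Pgt n a x z () () * Ggh n a z s () ())|
      ≤ cPPs 4 a * (cNear1 a / n) * latticeConst 4 (ghDelta a / 2) * E := by
    refine sum_abs_tsum_le_conv n (B (n - 1) β) (fun x z => Pgt n a x z () () * Ggh n a z (s + u) () () - Pgt n a x z () () * Ggh n a z s () ())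
      (fun x _ => (summable_Pgt_mul_Ggh n ha x (s + u)).sub (summable_Pgt_mul_Ggh n ha x s))
      (f := fun w => cPPs 4 a * Real.exp (-(deltaPP 4 a * dist β w))) (g := fun w => ∑ z ∈ B (n - 1) w, |Ggh n a z (s + u) () () - Ggh n a z s () ()|)
      (deltaPP_pos 4 ha) (ghDelta_pos ha) (cPPs_nonneg 4 ha) (div_nonneg (cNear1_nonneg ha) hn.le) β (blk (n - 1) s) (fun w => ?_)
      (fun w => mul_nonneg (cPPs_nonneg 4 ha) (Real.exp_pos _).le) (fun w => Finset.sum_nonneg fun z _ => abs_nonneg _) (fun w => le_rfl) hcol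
    show ∑ z ∈ B (n - 1) w, ∑ x ∈ B (n - 1) β, |Pgt n a x z () () * Ggh n a z (s + u) () () - Pgt n a x z () () * Ggh n a z s () ()|
      ≤ (cPPs 4 a * Real.exp (-(deltaPP 4 a * dist β w))) * ∑ z ∈ B (n - 1) w, |Ggh n a z (s + u) () () - Ggh n a z s () ()|
    rw [Finset.mul_sum]
    refine Finset.sum_le_sum fun z hz => ?_
    rw [show ∑ x ∈ B (n - 1) β, |Pgt n a x z () () * Ggh n a z (s + u) () () - Pgt n a x z () () * Ggh n a z s () ()|
        = (∑ x ∈ B (n - 1) β, |Pgt n a x z () ()|) * |Ggh n a z (s + u) () () - Ggh n a z s () ()| by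
      rw [Finset.sum_mul]; exact Finset.sum_congr rfl fun x _ => by rw [← mul_sub, abs_mul]]
    refine mul_le_mul_of_nonneg_right ?_ (abs_nonneg _)
    have hP := sum_B_abs_Pgt_le_sup n ha z β () ()
    rwa [mem_B.1 hz] at hP
  have e : ∀ x, RG (Ggh n a) (Pgt n a) x (s + u) () () - RG (Ggh n a) (Pgt n a) x s () ()
      = (Ggh n a x (s + u) () () - Ggh n a x s () ())
        - ∑' z : X 4, (Pgt n a x z () () * Ggh n a z (s + u) () () - Pgt n a x z () () * Ggh n a z s () ()) := by
    intro x
    rw [RG_apply, RG_apply, (summable_Pgt_mul_Ggh n ha x (s + u)).tsum_sub (summable_Pgt_mul_Ggh n ha x s)]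
    ring
  calc ∑ x ∈ B (n - 1) β, |RG (Ggh n a) (Pgt n a) x (s + u) () () - RG (Ggh n a) (Pgt n a) x s () ()|
      = ∑ x ∈ B (n - 1) β, |(Ggh n a x (s + u) () () - Ggh n a x s () ())
          - ∑' z : X 4, (Pgt n a x z () () * Ggh n a z (s + u) () () - Pgt n a x z () () * Ggh n a z s () ())| :=
        Finset.sum_congr rfl fun x _ => by rw [e x]
    _ ≤ _ := sum_abs_sub_le h1 h2
    _ = cNear1 a * (1 + cPPs 4 a * latticeConst 4 (ghDelta a / 2)) / n * E := by ring
    _ ≤ cRd a / n * E :=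
        mul_le_mul_of_nonneg_right (div_le_div_of_nonneg_right (cRd_bound₁ ha) hn.le) (Real.exp_pos _).le

/-- [folklore] **THE R-COLUMN BLOCK MASS OF THE DIFFERENCE IN THE SUMMED SLOT** (`m′_ρ`-class):
`Σ_{x ∈ B(β)} |RG(x+e_ρ,s) − RG(x,s)| ≤ cRd a∕n · e^{−dR a·dist(β, blk s)}` (PART 2a's summed-variable M10-d1 + M4-d1 ⊛ M10). -/
theorem sum_B_abs_RG_diff_col_le (ha : 0 < a) (s β : X 4) (ρ : Fin 4) :
    ∑ x ∈ B (n - 1) β, |RG (Ggh n a) (Pgt n a) (x + unitVec ρ) s () () - RG (Ggh n a) (Pgt n a) x s () ()|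
      ≤ cRd a / n * Real.exp (-(dR a * dist β (blk (n - 1) s))) := by
  have hn : (0 : ℝ) < n := Nat.cast_pos.mpr (Nat.pos_of_ne_zero (NeZero.ne n))
  set u : X 4 := unitVec ρ with hu
  set E := Real.exp (-(dR a * dist β (blk (n - 1) s))) with hE
  have hcol := sum_B_abs_Ggh_col_le n ha s
  have h1 : ∑ x ∈ B (n - 1) β, |Ggh n a (x + u) s () () - Ggh n a x s () ()| ≤ cNear1 a / n * E := by
    have h := sum_B_abs_Ggh_diff_summed_le n ha s β ρ
    rw [dist_comm] at h
    exact h.trans (mul_le_mul_of_nonneg_left (exp_ghDelta_le_exp_dR ha dist_nonneg) (div_nonneg (cNear1_nonneg ha) hn.le))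
  have h2 : ∑ x ∈ B (n - 1) β, |∑' z : X 4, (Pgt n a (x + u) z () () * Ggh n a z s () () - Pgt n a x z () () * Ggh n a z s () ())|
      ≤ cPPs 4 a / n * cNear a * latticeConst 4 (ghDelta a / 2) * E := by
    refine sum_abs_tsum_le_conv n (B (n - 1) β) (fun x z => Pgt n a (x + u) z () () * Ggh n a z s () () - Pgt n a x z () () * Ggh n a z s () ())
      (fun x _ => (summable_Pgt_mul_Ggh n ha (x + u) s).sub (summable_Pgt_mul_Ggh n ha x s))
      (f := fun w => cPPs 4 a / n * Real.exp (-(deltaPP 4 a * dist β w))) (g := fun w => ∑ z ∈ B (n - 1) w, |Ggh n a z s () ()|)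
      (deltaPP_pos 4 ha) (ghDelta_pos ha) (div_nonneg (cPPs_nonneg 4 ha) hn.le) (cNear_nonneg ha) β (blk (n - 1) s) (fun w => ?_)
      (fun w => mul_nonneg (div_nonneg (cPPs_nonneg 4 ha) hn.le) (Real.exp_pos _).le) (fun w => Finset.sum_nonneg fun z _ => abs_nonneg _)
      (fun w => le_rfl) hcol
    show ∑ z ∈ B (n - 1) w, ∑ x ∈ B (n - 1) β, |Pgt n a (x + u) z () () * Ggh n a z s () () - Pgt n a x z () () * Ggh n a z s () ()|
      ≤ (cPPs 4 a / n * Real.exp (-(deltaPP 4 a * dist β w))) * ∑ z ∈ B (n - 1) w, |Ggh n a z s () ()|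
    rw [Finset.mul_sum]
    refine Finset.sum_le_sum fun z hz => ?_
    rw [show ∑ x ∈ B (n - 1) β, |Pgt n a (x + u) z () () * Ggh n a z s () () - Pgt n a x z () () * Ggh n a z s () ()|
        = (∑ x ∈ B (n - 1) β, |Pgt n a (x + u) z () () - Pgt n a x z () ()|) * |Ggh n a z s () ()| by
      rw [Finset.sum_mul]; exact Finset.sum_congr rfl fun x _ => by rw [← sub_mul, abs_mul]]
    refine mul_le_mul_of_nonneg_right ?_ (abs_nonneg _)
    have hP := sum_B_abs_Pgt_diff_le_sup n ha z β ρ () ()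
    rw [show (e ρ : X 4) = u from rfl, mem_B.1 hz] at hP
    exact hP
  have e' : ∀ x, RG (Ggh n a) (Pgt n a) (x + u) s () () - RG (Ggh n a) (Pgt n a) x s () ()
      = (Ggh n a (x + u) s () () - Ggh n a x s () ())
        - ∑' z : X 4, (Pgt n a (x + u) z () () * Ggh n a z s () () - Pgt n a x z () () * Ggh n a z s () ()) := by
    intro x
    rw [RG_apply, RG_apply, (summable_Pgt_mul_Ggh n ha (x + u) s).tsum_sub (summable_Pgt_mul_Ggh n ha x s)]
    ring
  calc ∑ x ∈ B (n - 1) β, |RG (Ggh n a) (Pgt n a) (x + u) s () () - RG (Ggh n a) (Pgt n a) x s () ()|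
      = ∑ x ∈ B (n - 1) β, |(Ggh n a (x + u) s () () - Ggh n a x s () ())
          - ∑' z : X 4, (Pgt n a (x + u) z () () * Ggh n a z s () () - Pgt n a x z () () * Ggh n a z s () ())| :=
        Finset.sum_congr rfl fun x _ => by rw [e' x]
    _ ≤ _ := sum_abs_sub_le h1 h2
    _ = (cNear1 a + cPPs 4 a * cNear a * latticeConst 4 (ghDelta a / 2)) / n * E := by ring
    _ ≤ cRd a / n * E :=
        mul_le_mul_of_nonneg_right (div_le_div_of_nonneg_right (cRd_bound₂ ha) hn.le) (Real.exp_pos _).le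

/-! ## §3 Rows: `x` fixed, `s` summed over a block -/

/-- [folklore] **THE R-ROW BLOCK MASS** (an3 §3′ (6) «M10 = `Σ_{s∈B}|RG(x,s)| ≤ k`», with its block decay): `Σ_{s ∈ B(γ)} |RG(x,s)| ≤ cR a · e^{−dR a·dist(blk x, γ)}`
— M10 for `Ggh`, and the M4 block ROW of `Pgt` convolved with the M10 block rows of `Ggh`. -/
theorem sum_B_abs_RG_row_le (ha : 0 < a) (x γ : X 4) :
    ∑ s ∈ B (n - 1) γ, |RG (Ggh n a) (Pgt n a) x s () ()| ≤ cR a * Real.exp (-(dR a * dist (blk (n - 1) x) γ)) := by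
  set E := Real.exp (-(dR a * dist (blk (n - 1) x) γ)) with hE
  have h1 : ∑ s ∈ B (n - 1) γ, |Ggh n a x s () ()| ≤ cNear a * E :=
    (sum_B_abs_Ggh_le n ha x γ).trans (mul_le_mul_of_nonneg_left (exp_ghDelta_le_exp_dR ha dist_nonneg) (cNear_nonneg ha))
  have h2 : ∑ s ∈ B (n - 1) γ, |∑' z : X 4, Pgt n a x z () () * Ggh n a z s () ()|
      ≤ cPPs 4 a * cNear a * latticeConst 4 (ghDelta a / 2) * E := by
    refine sum_abs_tsum_le_conv n (B (n - 1) γ) (fun s z => Pgt n a x z () () * Ggh n a z s () ()) (fun s _ => summable_Pgt_mul_Ggh n ha x s)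
      (f := fun w => ∑ z ∈ B (n - 1) w, |Pgt n a x z () ()|) (g := fun w => cNear a * Real.exp (-(ghDelta a * dist w γ)))
      (deltaPP_pos 4 ha) (ghDelta_pos ha) (cPPs_nonneg 4 ha) (cNear_nonneg ha) (blk (n - 1) x) γ (fun w => ?_)
      (fun w => Finset.sum_nonneg fun z _ => abs_nonneg _) (fun w => mul_nonneg (cNear_nonneg ha) (Real.exp_pos _).le) (fun w => ?_)
      (fun w => le_rfl)
    · show ∑ z ∈ B (n - 1) w, ∑ s ∈ B (n - 1) γ, |Pgt n a x z () () * Ggh n a z s () ()|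
        ≤ (∑ z ∈ B (n - 1) w, |Pgt n a x z () ()|) * (cNear a * Real.exp (-(ghDelta a * dist w γ)))
      rw [Finset.sum_mul]
      refine Finset.sum_le_sum fun z hz => ?_
      rw [show ∑ s ∈ B (n - 1) γ, |Pgt n a x z () () * Ggh n a z s () ()| = |Pgt n a x z () ()| * ∑ s ∈ B (n - 1) γ, |Ggh n a z s () ()| by
        rw [Finset.mul_sum]; exact Finset.sum_congr rfl fun s _ => abs_mul _ _]
      refine mul_le_mul_of_nonneg_left ?_ (abs_nonneg _)
      have hG := sum_B_abs_Ggh_le n ha z γ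
      rwa [mem_B.1 hz] at hG
    · show ∑ z ∈ B (n - 1) w, |Pgt n a x z () ()| ≤ cPPs 4 a * Real.exp (-(deltaPP 4 a * dist (blk (n - 1) x) w))
      have hP := sum_B_abs_Pgt_row_le_sup n ha x w () ()
      rwa [dist_comm] at hP
  calc ∑ s ∈ B (n - 1) γ, |RG (Ggh n a) (Pgt n a) x s () ()|
      = ∑ s ∈ B (n - 1) γ, |Ggh n a x s () () - ∑' z : X 4, Pgt n a x z () () * Ggh n a z s () ()| :=
        Finset.sum_congr rfl fun s _ => by rw [RG_apply]
    _ ≤ _ := sum_abs_sub_le h1 h2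
    _ = cR a * E := by unfold cR; ring

/-- [folklore] **THE R-ROW BLOCK MASS OF THE DIFFERENCE IN THE FIXED SLOT** (an3 §3′ (6) «d1 twin `Σ_{s∈B}|RG(x+e,s) − RG(x,s)| ≤ k∕n`»):
`Σ_{s ∈ B(γ)} |RG(x+e_ρ,s) − RG(x,s)| ≤ cRd a∕n · e^{−dR a·dist(blk x, γ)}` (M10-d1 + M4-d1 row ⊛ M10). -/
theorem sum_B_abs_RG_diff_row_le (ha : 0 < a) (x γ : X 4) (ρ : Fin 4) :
    ∑ s ∈ B (n - 1) γ, |RG (Ggh n a) (Pgt n a) (x + unitVec ρ) s () () - RG (Ggh n a) (Pgt n a) x s () ()|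
      ≤ cRd a / n * Real.exp (-(dR a * dist (blk (n - 1) x) γ)) := by
  have hn : (0 : ℝ) < n := Nat.cast_pos.mpr (Nat.pos_of_ne_zero (NeZero.ne n))
  set u : X 4 := unitVec ρ with hu
  set E := Real.exp (-(dR a * dist (blk (n - 1) x) γ)) with hE
  have h1 : ∑ s ∈ B (n - 1) γ, |Ggh n a (x + u) s () () - Ggh n a x s () ()| ≤ cNear1 a / n * E :=
    (sum_B_abs_Ggh_diff_le n ha x γ ρ).trans
      (mul_le_mul_of_nonneg_left (exp_ghDelta_le_exp_dR ha dist_nonneg) (div_nonneg (cNear1_nonneg ha) hn.le))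
  have h2 : ∑ s ∈ B (n - 1) γ, |∑' z : X 4, (Pgt n a (x + u) z () () * Ggh n a z s () () - Pgt n a x z () () * Ggh n a z s () ())|
      ≤ cPPs 4 a / n * cNear a * latticeConst 4 (ghDelta a / 2) * E := by
    refine sum_abs_tsum_le_conv n (B (n - 1) γ) (fun s z => Pgt n a (x + u) z () () * Ggh n a z s () () - Pgt n a x z () () * Ggh n a z s () ())
      (fun s _ => (summable_Pgt_mul_Ggh n ha (x + u) s).sub (summable_Pgt_mul_Ggh n ha x s))
      (f := fun w => ∑ z ∈ B (n - 1) w, |Pgt n a (x + u) z () () - Pgt n a x z () ()|) (g := fun w => cNear a * Real.exp (-(ghDelta a * dist w γ)))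
      (deltaPP_pos 4 ha) (ghDelta_pos ha) (div_nonneg (cPPs_nonneg 4 ha) hn.le) (cNear_nonneg ha) (blk (n - 1) x) γ (fun w => ?_)
      (fun w => Finset.sum_nonneg fun z _ => abs_nonneg _) (fun w => mul_nonneg (cNear_nonneg ha) (Real.exp_pos _).le) (fun w => ?_)
      (fun w => le_rfl)
    · show ∑ z ∈ B (n - 1) w, ∑ s ∈ B (n - 1) γ, |Pgt n a (x + u) z () () * Ggh n a z s () () - Pgt n a x z () () * Ggh n a z s () ()|
        ≤ (∑ z ∈ B (n - 1) w, |Pgt n a (x + u) z () () - Pgt n a x z () ()|) * (cNear a * Real.exp (-(ghDelta a * dist w γ)))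
      rw [Finset.sum_mul]
      refine Finset.sum_le_sum fun z hz => ?_
      rw [show ∑ s ∈ B (n - 1) γ, |Pgt n a (x + u) z () () * Ggh n a z s () () - Pgt n a x z () () * Ggh n a z s () ()|
          = |Pgt n a (x + u) z () () - Pgt n a x z () ()| * ∑ s ∈ B (n - 1) γ, |Ggh n a z s () ()| by
        rw [Finset.mul_sum]; exact Finset.sum_congr rfl fun s _ => by rw [← sub_mul, abs_mul]]
      refine mul_le_mul_of_nonneg_left ?_ (abs_nonneg _)
      have hG := sum_B_abs_Ggh_le n ha z γ
      rwa [mem_B.1 hz] at hG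
    · show ∑ z ∈ B (n - 1) w, |Pgt n a (x + u) z () () - Pgt n a x z () ()| ≤ cPPs 4 a / n * Real.exp (-(deltaPP 4 a * dist (blk (n - 1) x) w))
      have hP := sum_B_abs_Pgt_diff_right_le_sup n ha x w ρ () ()
      rw [dist_comm, show (e ρ : X 4) = u from rfl] at hP
      refine le_trans (le_of_eq (Finset.sum_congr rfl fun z _ => ?_)) hP
      rw [Pgt_symm n ha (x + u) z () (), Pgt_symm n ha x z () ()]
  have e' : ∀ s, RG (Ggh n a) (Pgt n a) (x + u) s () () - RG (Ggh n a) (Pgt n a) x s () ()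
      = (Ggh n a (x + u) s () () - Ggh n a x s () ())
        - ∑' z : X 4, (Pgt n a (x + u) z () () * Ggh n a z s () () - Pgt n a x z () () * Ggh n a z s () ()) := by
    intro s
    rw [RG_apply, RG_apply, (summable_Pgt_mul_Ggh n ha (x + u) s).tsum_sub (summable_Pgt_mul_Ggh n ha x s)]
    ring
  calc ∑ s ∈ B (n - 1) γ, |RG (Ggh n a) (Pgt n a) (x + u) s () () - RG (Ggh n a) (Pgt n a) x s () ()|
      = ∑ s ∈ B (n - 1) γ, |(Ggh n a (x + u) s () () - Ggh n a x s () ())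
          - ∑' z : X 4, (Pgt n a (x + u) z () () * Ggh n a z s () () - Pgt n a x z () () * Ggh n a z s () ())| :=
        Finset.sum_congr rfl fun s _ => by rw [e' s]
    _ ≤ _ := sum_abs_sub_le h1 h2
    _ = (cNear1 a + cPPs 4 a * cNear a * latticeConst 4 (ghDelta a / 2)) / n * E := by ring
    _ ≤ cRd a / n * E :=
        mul_le_mul_of_nonneg_right (div_le_div_of_nonneg_right (cRd_bound₂ ha) hn.le) (Real.exp_pos _).le

end

end Summit.QuantumFields.BalabanUV.Beta.D1BFx.RColumnBlockMass
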